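/-
Copyright: statement-level skeleton of a published paper (lit-balaban cell, Phase-2 proof seat p19, gen 5). No claims beyond
what the kernel checks below.
-/
import Mathlib
import Literature.MathematicalPhysics.QuantumFieldTheory.Balaban1983to89.B3Prop21Except24Single
import Literature.MathematicalPhysics.QuantumFieldTheory.Balaban1983to89.B3IBPZeroBoxKernels

/-!
# B3 — T. Bałaban, *(Higgs)₂,₃ quantum fields in a finite volume. III. Renormalization*, CMP **88** (1983) 411–445
[Balaban1983Higgs3] — Proposition 2.1 pp. 424–428 WITH THE (2.4) EXCEPTION for the ZERO-FIELD BOX LINE CLASS: the IBP-ready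
amplitude built from the genuine propagator pieces, its family, and r15's `B3Prop1.Prop21` INHABITED with no line hypothesis

statement-level skeleton of published theorems with citation tags; proofs where landed; nothing here is a claim about
the Yang–Mills mass gap

PDF held: `paper:balaban1983-higgs-2-3-quantum-fields-finite-volume` (journal page = PDF page + 410); pp. 413, 420–421, 424–428
[PDF 3, 10–11, 14–18] read on the materialised text (`lit read … --pages 10-18`).

Part of the Phase-2 work on SKELETON rows **B3.Prop2.1 / B3.Prop2.2 / B3.Eq2.10** (unit `lit-balaban-p19` gen 5, HOME
`run/shared/lean/pub/lit-balaban/`): file 4 of the chain `B3AmpIBPSingle` → `B3Prop21Except24Single` → `B3IBPZeroBoxKernels` →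
`B3IBPZeroBox` (this file).  Own namespace; definitions with bodies (`SDGraph…`, `zbCounts`, `zbKb`, `zbK`, `VertexDataIBP`,
`iboxAmp`, `ParamsZB`, `DatumZB`, `expansionZB`, `famZB`, …) and theorems; no new `def … : Prop`; nothing existing is modified.

WHAT IS REPRODUCED.  Proposition 2.1 p. 424 [PDF 14], verbatim: *"Let G be a connected graph such that its each connected
subgraph, with the possible exception of the subgraphs (2.4), has a positive degree. Then we define G_ren = {G} and Proposition 1
holds in this case."*, with its printed proof pp. 424–428 ((2.6)/(2.7), the integration by parts (2.8)/(2.9), (2.10), (2.13),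
(2.15)) — gen 4 landed it as `B3Prop21Except24.prop21_except24` for amplitudes whose analytic side (the fields of `IBPAmp`:
`K_l = ∂⁺K♭_l`, (2.10) with its derivative budget, the face-vanishing localization) was HYPOTHESIS.  KERNEL-CHECKED HERE, for the
MODEL INSTANCE `A = B̃ = 0`, `Ω = □` (the scope of seat p03's lineage `B3Ineq210ZeroBox` / `B3Ineq213ZeroBoxLines` /
`B3Ineq213ZeroBoxDiffLines`, kind «model-instance»): the graphs `SDGraph` (lines with endpoints, connected; each vertex with AT
MOST ONE derivative leg `der v` = a leg of a line at `v`, and its bond direction `dir v` — the vertices (1.8)/(1.9) p. 413 have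
one leg `D^η_{B̃,μ}φ′`, the others none), their count data `zbCounts` (= p03's `dboxCounts` of the induced leg derivatives), and
the amplitude **`iboxAmp`** whose line kernels ARE the lattice difference quotients of the cut-off zero-field box pieces
`ζ(x)ζ(y)η^{−(d+1)}G^η_{(t)}(□,0;x,y)` of `B3IBPZeroBoxKernels` dictated by the derivative legs (`zbK`: `∂⁺_{dir s(l)}` in `x` if
the derivative leg of `s(l)` is the first leg of `l`, `∂⁺_{dir t(l)}` in `y` likewise) — an amplitude of the PRINT-STRENGTH IBP-ready
class `IBPAmp₁` of `B3AmpIBPSingle` with EVERY analytic field PROVED: `single` (one derivative leg per vertex), `K_eq` (by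
construction), (2.10) for `K`, `K♭` and the derivative budget where (2.8) can differentiate (`B3IBPZeroBoxKernels.abs_*_cutK_le` +
the conversions `KBd.dK_*`), constants `Cz = 4C(1+…)`-free of the graph; the VERTEX side (vertex functions with their bound,
face-vanishing in `dir v` and the differentiated bound `cD` at the vertices carrying a derivative leg) stays the datum
`VertexDataIBP` (p03's `VertexData` + the two IBP clauses), as in p03's files.  Then the multi-graph expansion `expansionZB` of
r15's carrier (classes = graphs = `SDGraph`s with `≤ mb` lines, `E` = the total amplitude, subgraphs = components along orderings
with degrees `degQ`, `Is24 := Is24Block`) and **`prop21_zeroBox : B3Prop1.Prop21 (famZB P mbar)`** — `δ₀ = ½δ₁(d, L, window)`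
first, `O(1)(n̄) = unifO1x` of gen 4, for EVERY datum (scale `k ≥ 1`, window point, box, couplings, vertex data) and every graph
satisfying the printed hypothesis `PosSubgraphsExcept24`; `datumZB_nonempty`.  On vertex cubes one unit inside `□` the cutoff is
invisible (`B3IBPZeroBoxKernels.cutK_eq_lineK`), so `E` is the amplitude with the genuine pieces there.  HONEST SCOPE: zero
background field and a box only; scalar lines only (no averaged vector legs (2.12)); the vertex side is data; the cutoff `ζ` is
part of the kernel (it coincides with the print's smooth localization of the legs one unit inside `□`).
-/

open Finset

namespace Literature.MathematicalPhysics.QuantumFieldTheory.Balaban1983to89.B3IBPZeroBox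

open Literature.MathematicalPhysics.QuantumFieldTheory.Balaban1983to89.B3Ineq215
open Literature.MathematicalPhysics.QuantumFieldTheory.Balaban1983to89.B3Ineq213
open Literature.MathematicalPhysics.QuantumFieldTheory.Balaban1983to89.B3Ineq213ZeroBoxLines
open Literature.MathematicalPhysics.QuantumFieldTheory.Balaban1983to89.B3Ineq213ZeroBoxDiffLines (DLineGraph dboxCounts
  dtoModel_a dtoModel_sc dtoModel_Lpow rhs210 ddelta1 dconst ddelta1_pos dconst_pos)
open Literature.MathematicalPhysics.QuantumFieldTheory.Balaban1983to89.B3IBPZeroBoxKernels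
open Literature.MathematicalPhysics.QuantumFieldTheory.Balaban1983to89.B4Thm110ZeroBox (Nf)
open B3Sect2FirstEstimate B3Prop1

noncomputable section

variable {V : Type} [Fintype V] [DecidableEq V] {m d : ℕ}

/-! ## §1 The graphs: lines, endpoints, one derivative leg per vertex -/

/-- **A graph of the zero-field box class with derivative legs**: the data of p03's `LineGraph` (lines with endpoints, every
vertex on a line, connected, the η-powers of the vertices) plus, per vertex, AT MOST ONE derivative leg `der v = (l, e)` — the leg
`e` (`true` = first, `false` = second) of the line `l` at `v` — with its bond direction `dir v`: the vertices (1.8)/(1.9) p. 413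
carry one leg `(D^η_{B̃,μ}φ′)(b)`, the other vertices none. [cite: Balaban1983Higgs3, (1.8) p.413, Prop. 2.1 p.424] -/
structure SDGraph (V : Type) [Fintype V] [DecidableEq V] (m d : ℕ) extends LineGraph V m where
  /-- the derivative leg of `v`, if any: (line, which leg) -/
  der : V → Option (Fin m × Bool)
  /-- the bond direction of the derivative leg of `v` -/
  dir : V → Fin (d + 1)
  /-- the derivative leg of `v` is a leg at `v` -/
  der_at : ∀ v l e, der v = some (l, e) → (if e then src l = v else tgt l = v)

namespace SDGraph

variable (Γ : SDGraph V m d)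

/-- The first leg of `l` carries the derivative of `s(l)`. [cite: Balaban1983Higgs3, (1.8) p.413] -/
def DS (l : Fin m) : Prop := Γ.der (Γ.src l) = some (l, true)

/-- The second leg of `l` carries the derivative of `t(l)`. [cite: Balaban1983Higgs3, (1.8) p.413] -/
def DT (l : Fin m) : Prop := Γ.der (Γ.tgt l) = some (l, false)

/-- `DS` is decidable (an equality of options). [cite: Balaban1983Higgs3, (1.8) p.413] -/
instance (l : Fin m) : Decidable (Γ.DS l) := inferInstanceAs (Decidable (_ = _))

/-- `DT` is decidable (an equality of options). [cite: Balaban1983Higgs3, (1.8) p.413] -/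
instance (l : Fin m) : Decidable (Γ.DT l) := inferInstanceAs (Decidable (_ = _))

/-- The induced graph-with-differentiated-legs of p03 (directions of the leg derivatives). [cite: Balaban1983Higgs3, (2.1) p.422] -/
def toDLineGraph : DLineGraph V m d where
  toLineGraph := Γ.toLineGraph
  dSrc := fun l => if Γ.DS l then some (Γ.dir (Γ.src l)) else none
  dTgt := fun l => if Γ.DT l then some (Γ.dir (Γ.tgt l)) else none

/-- The number of derivatives on the first leg of `l`. [cite: Balaban1983Higgs3, (2.1) p.422] -/
theorem nd_dSrc (l : Fin m) : B3Ineq213ZeroBoxDiffLines.nd (Γ.toDLineGraph.dSrc l) = if Γ.DS l then 1 else 0 := by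
  unfold toDLineGraph B3Ineq213ZeroBoxDiffLines.nd
  by_cases h : Γ.DS l <;> simp [h]

/-- The number of derivatives on the second leg of `l`. [cite: Balaban1983Higgs3, (2.1) p.422] -/
theorem nd_dTgt (l : Fin m) : B3Ineq213ZeroBoxDiffLines.nd (Γ.toDLineGraph.dTgt l) = if Γ.DT l then 1 else 0 := by
  unfold toDLineGraph B3Ineq213ZeroBoxDiffLines.nd
  by_cases h : Γ.DT l <;> simp [h]

end SDGraph

/-- **The count datum** of a graph of the class (p03's `dboxCounts` of the induced leg derivatives: `diffOn v l` = the number of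
derivative legs of `v` on `l`, no averaged legs, dimension `d + 1`, `L = ℓ + 1`, `δ₁` of p03's `dlineK_le`).
[cite: Balaban1983Higgs3, (2.14) p.427] -/
def zbCounts (Γ : SDGraph V m d) (ℓ : ℕ) (hℓ : 1 ≤ ℓ) (amin aplus m2plus : ℝ) (ha : 0 < amin) : Counts V m :=
  dboxCounts Γ.toDLineGraph ℓ hℓ amin aplus m2plus ha

section CountsFacts

variable (Γ : SDGraph V m d) (ℓ : ℕ) (hℓ : 1 ≤ ℓ) (amin aplus m2plus : ℝ) (ha : 0 < amin)

/-- The differentiation counts of the datum. [cite: Balaban1983Higgs3, (2.1) p.422] -/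
theorem zbCounts_diffOn (v : V) (l : Fin m) : (zbCounts Γ ℓ hℓ amin aplus m2plus ha).diffOn v l
    = (if Γ.src l = v then (if Γ.DS l then 1 else 0) else 0) + (if Γ.tgt l = v then (if Γ.DT l then 1 else 0) else 0) := by
  show (if Γ.src l = v then B3Ineq213ZeroBoxDiffLines.nd (Γ.toDLineGraph.dSrc l) else 0)
      + (if Γ.tgt l = v then B3Ineq213ZeroBoxDiffLines.nd (Γ.toDLineGraph.dTgt l) else 0) = _
  rw [Γ.nd_dSrc, Γ.nd_dTgt]

/-- **One derivative leg per vertex**: if a vertex differentiates the line `l`, it differentiates no other line.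
[cite: Balaban1983Higgs3, (1.8) p.413] -/
theorem zbCounts_single (v : V) (l l' : Fin m) (hne : l ≠ l') (h1 : 1 ≤ (zbCounts Γ ℓ hℓ amin aplus m2plus ha).diffOn v l) :
    (zbCounts Γ ℓ hℓ amin aplus m2plus ha).diffOn v l' = 0 := by
  rw [zbCounts_diffOn] at h1 ⊢
  -- the derivative leg of `v` is a leg of `l`
  have hder : ∃ e, Γ.der v = some (l, e) := by
    by_contra hno
    push Not at hno
    have hS : ¬ (Γ.src l = v ∧ Γ.DS l) := fun h => hno true (h.1 ▸ h.2)
    have hT : ¬ (Γ.tgt l = v ∧ Γ.DT l) := fun h => hno false (h.1 ▸ h.2)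
    have e1 : (if Γ.src l = v then (if Γ.DS l then 1 else 0) else 0) = (0 : ℕ) := by
      split_ifs with ha' hb' <;> simp_all
    have e2 : (if Γ.tgt l = v then (if Γ.DT l then 1 else 0) else 0) = (0 : ℕ) := by
      split_ifs with ha' hb' <;> simp_all
    omega
  obtain ⟨e, he⟩ := hder
  have hS' : ¬ (Γ.src l' = v ∧ Γ.DS l') := by
    rintro ⟨hv, hD⟩
    unfold SDGraph.DS at hD
    rw [hv, he] at hD
    simp only [Option.some.injEq, Prod.mk.injEq] at hD
    exact hne hD.1
  have hT' : ¬ (Γ.tgt l' = v ∧ Γ.DT l') := by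
    rintro ⟨hv, hD⟩
    unfold SDGraph.DT at hD
    rw [hv, he] at hD
    simp only [Option.some.injEq, Prod.mk.injEq] at hD
    exact hne hD.1
  have e1 : (if Γ.src l' = v then (if Γ.DS l' then 1 else 0) else 0) = (0 : ℕ) := by
    split_ifs with ha' hb' <;> simp_all
  have e2 : (if Γ.tgt l' = v then (if Γ.DT l' then 1 else 0) else 0) = (0 : ℕ) := by
    split_ifs with ha' hb' <;> simp_all
  omega

/-- A derivative on the first leg, read off the counts (two endpoints). [cite: Balaban1983Higgs3, (2.1) p.422] -/
theorem DS_of_diffOn {l : Fin m} (hne : Γ.src l ≠ Γ.tgt l) (h1 : 1 ≤ (zbCounts Γ ℓ hℓ amin aplus m2plus ha).diffOn (Γ.src l) l) :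
    Γ.DS l := by
  rw [zbCounts_diffOn, if_pos rfl, if_neg (Ne.symm hne)] at h1
  by_contra h
  rw [if_neg h] at h1
  omega

/-- No derivative of `s(l)` on `l`, read off the counts. [cite: Balaban1983Higgs3, (2.1) p.422] -/
theorem not_DS_of_diffOn {l : Fin m} (h0 : (zbCounts Γ ℓ hℓ amin aplus m2plus ha).diffOn (Γ.src l) l = 0) : ¬ Γ.DS l := by
  intro h
  rw [zbCounts_diffOn, if_pos rfl, if_pos h] at h0
  omega

/-- No derivative of `t(l)` on `l`, read off the counts. [cite: Balaban1983Higgs3, (2.1) p.422] -/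
theorem not_DT_of_diffOn {l : Fin m} (h0 : (zbCounts Γ ℓ hℓ amin aplus m2plus ha).diffOn (Γ.tgt l) l = 0) : ¬ Γ.DT l := by
  intro h
  rw [zbCounts_diffOn, if_pos rfl, if_pos h] at h0
  omega

/-- **The line dimension**: `a_l = 2 − (d+1) − #{derivative legs on l}`. [cite: Balaban1983Higgs3, (2.14) p.427] -/
theorem zb_a (l : Fin m) : (zbCounts Γ ℓ hℓ amin aplus m2plus ha).toModel.a l
    = (2 : ℝ) - ((d + 1 : ℕ) : ℝ) - (((if Γ.DS l then 1 else 0) + (if Γ.DT l then 1 else 0) : ℕ) : ℝ) := by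
  unfold zbCounts
  rw [dtoModel_a, Γ.nd_dSrc, Γ.nd_dTgt]

/-- The model's scale is p03's `bscale`. [cite: Balaban1983Higgs3, (2.10) p.426] -/
theorem zb_sc (k t : ℕ) : (zbCounts Γ ℓ hℓ amin aplus m2plus ha).toModel.sc k t = bscale ℓ k t :=
  dtoModel_sc Γ.toDLineGraph ℓ hℓ amin aplus m2plus ha k t

/-- The model's `L^k`. [cite: Balaban1983Higgs3, (2.10) p.426] -/
theorem zb_Lpow (k : ℕ) : (((zbCounts Γ ℓ hℓ amin aplus m2plus ha).toModel.L : ℝ) ^ k) = (((ℓ + 1) ^ k : ℕ) : ℝ) :=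
  dtoModel_Lpow Γ.toDLineGraph ℓ hℓ amin aplus m2plus ha k

/-- The model's `e^{2δ₀} = e^{δ₁}`. [cite: Balaban1983Higgs3, (2.10) p.426] -/
theorem zb_Esh : Esh (zbCounts Γ ℓ hℓ amin aplus m2plus ha).toModel = Real.exp (ddelta1 d ℓ hℓ amin aplus m2plus ha) := by
  show Real.exp (2 * (ddelta1 d ℓ hℓ amin aplus m2plus ha / 2)) = _
  ring_nf

end CountsFacts

/-! ## §2 The constants and the conversion of p03's bound shape to gen 4's `KBd` -/

/-- **The kernel constant of the class**: `Cz = 4C·e^{2δ₁}` (`C, δ₁` of p03's `dlineK_le`; `4` from the two cutoffs, `e^{2δ₁}` from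
reading backward differences one unit off). [cite: Balaban1983Higgs3, (2.10) p.426] -/
def Cz (d ℓ : ℕ) (hℓ : 1 ≤ ℓ) (amin aplus m2plus : ℝ) (ha : 0 < amin) : ℝ :=
  4 * dconst d ℓ hℓ amin aplus m2plus ha * (Real.exp (ddelta1 d ℓ hℓ amin aplus m2plus ha)) ^ 2

section Conversion

variable (Γ : SDGraph V m d) (ℓ : ℕ) (hℓ : 1 ≤ ℓ) (amin aplus m2plus : ℝ) (ha : 0 < amin)

/-- `Cz > 0`. [cite: Balaban1983Higgs3, (2.10) p.426] -/
theorem Cz_pos : 0 < Cz d ℓ hℓ amin aplus m2plus ha := by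
  unfold Cz
  have := dconst_pos d ℓ hℓ amin aplus m2plus ha
  positivity

/-- Every constant met (`cC·e^{jδ₁}`, `c ≤ 4`, `j ≤ 2`) is below `Cz`. [cite: Balaban1983Higgs3, (2.10) p.426] -/
theorem le_Cz {c : ℝ} (hc : c ≤ 4) {j : ℕ} (hj : j ≤ 2) :
    c * dconst d ℓ hℓ amin aplus m2plus ha * Esh (zbCounts Γ ℓ hℓ amin aplus m2plus ha).toModel ^ j
      ≤ Cz d ℓ hℓ amin aplus m2plus ha := by
  rw [zb_Esh]
  unfold Cz
  have hC := (dconst_pos d ℓ hℓ amin aplus m2plus ha).le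
  have hE : 1 ≤ Real.exp (ddelta1 d ℓ hℓ amin aplus m2plus ha) :=
    Real.one_le_exp (ddelta1_pos d ℓ hℓ amin aplus m2plus ha).le
  calc c * dconst d ℓ hℓ amin aplus m2plus ha * Real.exp (ddelta1 d ℓ hℓ amin aplus m2plus ha) ^ j
      ≤ 4 * dconst d ℓ hℓ amin aplus m2plus ha * Real.exp (ddelta1 d ℓ hℓ amin aplus m2plus ha) ^ 2 :=
        mul_le_mul (mul_le_mul_of_nonneg_right hc hC) (pow_le_pow_right₀ hE hj) (pow_nonneg (by positivity) _)
          (by positivity)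
    _ = _ := rfl

/-- **p03's (2.10) shape is gen 4's `KBd`** for the model of the class: `|F| ≤ rhs210 δ₁ C n` for `t < k` gives
`KBd … k C (2 − (d+1) − n) F`. [cite: Balaban1983Higgs3, (2.10) p.426] -/
theorem KBd_of_rhs210 {k : ℕ} {F : Ker (d + 1)} {C : ℝ} {n : ℕ} {e : ℝ} (he : e = (2 : ℝ) - ((d + 1 : ℕ) : ℝ) - (n : ℝ))
    (h : ∀ t, t < k → ∀ x y, |F t x y| ≤ rhs210 ℓ k (ddelta1 d ℓ hℓ amin aplus m2plus ha) C n t x y) :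
    KBd (zbCounts Γ ℓ hℓ amin aplus m2plus ha).toModel k C e F := by
  intro t ht x y
  have hδ : (zbCounts Γ ℓ hℓ amin aplus m2plus ha).toModel.δ₀ = ddelta1 d ℓ hℓ amin aplus m2plus ha / 2 := rfl
  have hexp : Real.exp (-(2 * (ddelta1 d ℓ hℓ amin aplus m2plus ha / 2) / bscale ℓ k t
      * ((((zbCounts Γ ℓ hℓ amin aplus m2plus ha).toModel.L : ℝ) ^ k)⁻¹ * (supDist x y : ℝ))))
      = Real.exp (-(ddelta1 d ℓ hℓ amin aplus m2plus ha * (bscale ℓ k t)⁻¹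
          * ((supDist x y : ℝ) / (((ℓ + 1) ^ k : ℕ) : ℝ)))) := by
    congr 1
    rw [zb_Lpow]
    ring
  rw [zb_sc, hδ, hexp, he]
  exact h t ht x y

/-- A `KBd` bound with a constant below `Cz` is a `KBd` bound with `Cz`. [cite: Balaban1983Higgs3, (2.10) p.426] -/
theorem KBd_Cz {k : ℕ} {F : Ker (d + 1)} {c : ℝ} (hc : c ≤ 4) {j : ℕ} (hj : j ≤ 2) {e : ℝ}
    (h : KBd (zbCounts Γ ℓ hℓ amin aplus m2plus ha).toModel k
      (c * dconst d ℓ hℓ amin aplus m2plus ha * Esh (zbCounts Γ ℓ hℓ amin aplus m2plus ha).toModel ^ j) e F) :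
    KBd (zbCounts Γ ℓ hℓ amin aplus m2plus ha).toModel k (Cz d ℓ hℓ amin aplus m2plus ha) e F :=
  h.mono (le_Cz Γ ℓ hℓ amin aplus m2plus ha hc hj)

end Conversion

/-! ## §3 The line kernels: lattice difference quotients of the cut-off pieces dictated by the derivative legs -/

section Kernels

variable (Γ : SDGraph V m d) (ℓ k : ℕ) (M : Fin (d + 1) → ℕ) (a m2 : ℝ)

/-- The mesh factor `η^{−1} = L^k`. [cite: Balaban1983Higgs3, (2.8) p.425] -/
def s₀ (ℓ k : ℕ) : ℝ := (((ℓ + 1) ^ k : ℕ) : ℝ)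

/-- **The `x`-undifferentiated kernel `K♭_l`**: the cut-off piece, differenced in `y` (`∂⁺_{dir t(l)}`) iff the derivative leg of
`t(l)` is the second leg of `l`. [cite: Balaban1983Higgs3, (2.8) p.425] -/
def zbKb (l : Fin m) : Ker (d + 1) :=
  if Γ.DT l then fdY (s₀ ℓ k) (Γ.dir (Γ.tgt l)) (cutK ℓ k M a m2) else cutK ℓ k M a m2

/-- **The line kernel `K_l`**: `K♭_l`, differenced in `x` (`∂⁺_{dir s(l)}`) iff the derivative leg of `s(l)` is the first leg of
`l`. [cite: Balaban1983Higgs3, (2.8) p.425, (2.10) p.426] -/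
def zbK (l : Fin m) : Ker (d + 1) :=
  if Γ.DS l then fdX (s₀ ℓ k) (Γ.dir (Γ.src l)) (zbKb Γ ℓ k M a m2 l) else zbKb Γ ℓ k M a m2 l

/-- Forward differences in the two variables commute. [cite: Balaban1983Higgs3, (2.8) p.425] -/
theorem fdY_fdX_comm {n : ℕ} (s : ℝ) (μ ν : Fin n) (F : Ker n) : fdY s ν (fdX s μ F) = fdX s μ (fdY s ν F) := by
  funext t x y
  simp only [fdX_apply, fdY_apply]
  ring

end Kernels

section KernelBounds

variable {ℓ k : ℕ} {M : Fin (d + 1) → ℕ} {a m2 : ℝ} (hℓ : 1 ≤ ℓ) (amin aplus m2plus : ℝ) (ha : 0 < amin) (hk : 1 ≤ k)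
  (h1 : amin ≤ a) (h2 : a ≤ aplus) (h3 : 0 ≤ m2) (h4 : m2 ≤ m2plus) (hM : ∀ i, 1 ≤ M i)

include hk h1 h2 h3 h4 hM in
/-- (2.10) with two differentiations for the mixed forward difference taken in the other order.
[cite: Balaban1983Higgs3, (2.10) p.426] -/
theorem abs_fdYX_cutK_le {t : ℕ} (ht : t < k) (μ ν : Fin (d + 1)) (x y : Fin (d + 1) → ℕ) :
    |fdY (s₀ ℓ k) ν (fdX (s₀ ℓ k) μ (cutK ℓ k M a m2)) t x y|
      ≤ rhs210 ℓ k (ddelta1 d ℓ hℓ amin aplus m2plus ha) (4 * dconst d ℓ hℓ amin aplus m2plus ha) 2 t x y := by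
  rw [fdY_fdX_comm]
  exact abs_fdXY_cutK_le hℓ amin aplus m2plus ha hk h1 h2 h3 h4 hM ht μ ν x y

end KernelBounds

/-! ## §4 The vertex side (data) with the two IBP clauses -/

/-- **The vertex datum of an IBP-ready amplitude of the class**: p03's `VertexData` (vertex functions `u_v` with the bound
`|u_v| ≤ e^{d_v}λ^{d_s}N^Φ_vN^A_vη^{e_v}`) plus, at every vertex carrying a derivative leg, the face-vanishing of `u_v` on the
`dir v`-faces of `□(v)` (the smooth localization g of (2.8), p. 420) and the differentiated bound `|∂⁻_{dir v}u_v| ≤ cD × (bound)`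
(*"This applies also to Hölder norms"*, p. 426: the norms (1.32) contain the first derivatives). [cite: Balaban1983Higgs3, (2.8) p.425] -/
structure VertexDataIBP (Γ : SDGraph V m d) (ℓ k : ℕ) (box : V → Fin (d + 1) → ℕ) extends VertexData V d ℓ k Γ.etaPow where
  /-- the constant of the differentiated vertex bound -/
  cD : ℝ
  one_le_cD : 1 ≤ cD
  /-- at a vertex with a derivative leg, `u_v` vanishes on the two `dir v`-faces of `□(v)` -/
  u_face : ∀ v, Γ.der v ≠ none → FaceVanishing (ℓ + 1) (⟨k, box v⟩ : Cube (d + 1)) (Γ.dir v) (u v)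
  /-- at a vertex with a derivative leg, the differentiated vertex bound -/
  du_le : ∀ v, Γ.der v ≠ none → ∀ x, |bdiffQ ((((ℓ + 1 : ℕ) : ℝ)) ^ k) (Γ.dir v) (u v) x|
    ≤ cD * (eRun ^ dv v * lamRun ^ ds v * NPhi v * NA v * (((((ℓ + 1 : ℕ) : ℝ)) ^ k)⁻¹) ^ (Γ.etaPow v : ℝ))

/-- **The zero vertex datum** (all `u_v = 0`, couplings `1`, norms `1`, `cD = 1`): the datum type is inhabited for every graph
and localization. [cite: Balaban1983Higgs3, (2.13) p.426] -/
def VertexDataIBP.zero (Γ : SDGraph V m d) (ℓ k : ℕ) (box : V → Fin (d + 1) → ℕ) : VertexDataIBP Γ ℓ k box where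
  u := fun _ _ => 0
  eRun := 1
  lamRun := 1
  dv := fun _ => 0
  ds := fun _ => 0
  NPhi := fun _ => 1
  NA := fun _ => 1
  eRun_nonneg := zero_le_one
  lamRun_nonneg := zero_le_one
  NPhi_nonneg := fun _ => zero_le_one
  NA_nonneg := fun _ => zero_le_one
  u_le := fun v x => by
    rw [abs_zero]
    positivity
  cD := 1
  one_le_cD := le_rfl
  u_face := fun v _ x _ => rfl
  du_le := fun v _ x => by
    simp only [bdiffQ, sub_self, mul_zero, abs_zero, one_mul]
    positivity

/-! ## §5 The IBP-ready amplitude of the zero-field box class -/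

section Amplitude

variable (Γ : SDGraph V m d) (ℓ : ℕ) (hℓ : 1 ≤ ℓ) (amin aplus m2plus : ℝ) (ha : 0 < amin) {k : ℕ} (hk : 1 ≤ k)
  {a m2 : ℝ} (h1 : amin ≤ a) (h2 : a ≤ aplus) (h3 : 0 ≤ m2) (h4 : m2 ≤ m2plus) (M : Fin (d + 1) → ℕ)
  (hM : ∀ i, 1 ≤ M i) (box : V → Fin (d + 1) → ℕ) (P : VertexDataIBP Γ ℓ k box)

/-- The mesh of the model is `s₀ = L^k`. [cite: Balaban1983Higgs3, (2.8) p.425] -/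
theorem zb_Lpow_eq_s₀ : (((zbCounts Γ ℓ hℓ amin aplus m2plus ha).toModel.L : ℝ) ^ k) = s₀ ℓ k :=
  zb_Lpow Γ ℓ hℓ amin aplus m2plus ha k

/-- `(L : ℝ)^k` of the vertex datum is `s₀`. [cite: Balaban1983Higgs3, (2.8) p.425] -/
theorem cast_pow_eq_s₀ : ((((ℓ + 1 : ℕ) : ℝ)) ^ k) = s₀ ℓ k := by
  unfold s₀; push_cast; ring

include hk h1 h2 h3 h4 hM in
/-- **(2.10) for `K♭_l`** (exponent `2 − (d+1) − [t(l) differentiates l]`). [cite: Balaban1983Higgs3, (2.10) p.426] -/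
theorem KBd_zbKb (l : Fin m) :
    KBd (zbCounts Γ ℓ hℓ amin aplus m2plus ha).toModel k (Cz d ℓ hℓ amin aplus m2plus ha)
      ((2 : ℝ) - ((d + 1 : ℕ) : ℝ) - (((if Γ.DT l then 1 else 0 : ℕ)) : ℝ)) (zbKb Γ ℓ k M a m2 l) := by
  unfold zbKb
  by_cases hT : Γ.DT l
  · rw [if_pos hT, if_pos hT]
    refine KBd_Cz Γ ℓ hℓ amin aplus m2plus ha (c := 2) (by norm_num) (j := 0) (by norm_num) ?_
    rw [pow_zero, mul_one]
    exact KBd_of_rhs210 Γ ℓ hℓ amin aplus m2plus ha (n := 1) (by norm_num)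
      fun t ht x y => abs_fdY_cutK_le hℓ amin aplus m2plus ha hk h1 h2 h3 h4 hM ht _ x y
  · rw [if_neg hT, if_neg hT]
    refine KBd_Cz Γ ℓ hℓ amin aplus m2plus ha (c := 1) (by norm_num) (j := 0) (by norm_num) ?_
    rw [pow_zero, mul_one, one_mul]
    exact KBd_of_rhs210 Γ ℓ hℓ amin aplus m2plus ha (n := 0) (by norm_num)
      fun t ht x y => abs_cutK_le hℓ amin aplus m2plus ha hk h1 h2 h3 h4 hM ht x y

include hk h1 h2 h3 h4 hM in
/-- **(2.10) for `∂⁺_μ K♭_l` in `x`** (one more derivative). [cite: Balaban1983Higgs3, (2.10) p.426] -/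
theorem KBd_fdX_zbKb (l : Fin m) (μ : Fin (d + 1)) :
    KBd (zbCounts Γ ℓ hℓ amin aplus m2plus ha).toModel k (Cz d ℓ hℓ amin aplus m2plus ha)
      ((2 : ℝ) - ((d + 1 : ℕ) : ℝ) - (((if Γ.DT l then 1 else 0 : ℕ)) : ℝ) - 1) (fdX (s₀ ℓ k) μ (zbKb Γ ℓ k M a m2 l)) := by
  unfold zbKb
  by_cases hT : Γ.DT l
  · rw [if_pos hT, if_pos hT]
    refine KBd_Cz Γ ℓ hℓ amin aplus m2plus ha (c := 4) (by norm_num) (j := 0) (by norm_num) ?_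
    rw [pow_zero, mul_one]
    exact KBd_of_rhs210 Γ ℓ hℓ amin aplus m2plus ha (n := 2) (by push_cast; ring)
      fun t ht x y => abs_fdXY_cutK_le hℓ amin aplus m2plus ha hk h1 h2 h3 h4 hM ht μ _ x y
  · rw [if_neg hT, if_neg hT]
    refine KBd_Cz Γ ℓ hℓ amin aplus m2plus ha (c := 2) (by norm_num) (j := 0) (by norm_num) ?_
    rw [pow_zero, mul_one]
    exact KBd_of_rhs210 Γ ℓ hℓ amin aplus m2plus ha (n := 1) (by push_cast; ring)
      fun t ht x y => abs_fdX_cutK_le hℓ amin aplus m2plus ha hk h1 h2 h3 h4 hM ht μ x y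

include hk h1 h2 h3 h4 hM in
/-- **(2.10) for the line kernel `K_l`** (exponent `a_l`). [cite: Balaban1983Higgs3, (2.10) p.426] -/
theorem KBd_zbK (l : Fin m) :
    KBd (zbCounts Γ ℓ hℓ amin aplus m2plus ha).toModel k (Cz d ℓ hℓ amin aplus m2plus ha)
      ((zbCounts Γ ℓ hℓ amin aplus m2plus ha).toModel.a l) (zbK Γ ℓ k M a m2 l) := by
  rw [zb_a]
  unfold zbK
  by_cases hS : Γ.DS l
  · rw [if_pos hS, if_pos hS]
    exact (KBd_fdX_zbKb Γ ℓ hℓ amin aplus m2plus ha hk h1 h2 h3 h4 M hM l _).of_eq (by push_cast; ring)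
  · rw [if_neg hS, if_neg hS]
    exact (KBd_zbKb Γ ℓ hℓ amin aplus m2plus ha hk h1 h2 h3 h4 M hM l).of_eq (by push_cast; ring)

/-- **The IBP-ready localized lattice amplitude of a graph of the zero-field box class** (print-strength class `IBPAmp₁` over
`zbCounts`), scale `k ≥ 1` (`η = L^{−k}`), window point `(a, m²)`, box `□ = Π[0, M_i)`, localization `{□(v)}`, vertex datum `P`:
LINE KERNELS = the difference quotients `zbK` of the cut-off zero-field box pieces, `K♭ = zbKb`, constants `Cz`; EVERY analytic
field of the class PROVED (`single`, `K_eq`, (2.10) for `K`/`K♭`, the derivative budget where (2.8) can act).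
[cite: Balaban1983Higgs3, Prop. 2.1 p.424, (2.8) p.425, (2.10) p.426] -/
def iboxAmp : IBPAmp₁ (zbCounts Γ ℓ hℓ amin aplus m2plus ha) where
  k := k
  box := box
  u := P.u
  K := zbK Γ ℓ k M a m2
  C := fun _ => Cz d ℓ hℓ amin aplus m2plus ha
  eRun := P.eRun
  lamRun := P.lamRun
  dv := P.dv
  ds := P.ds
  NPhi := P.NPhi
  NA := P.NA
  C_nonneg := fun _ => (Cz_pos ℓ hℓ amin aplus m2plus ha).le
  eRun_nonneg := P.eRun_nonneg
  lamRun_nonneg := P.lamRun_nonneg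
  NPhi_nonneg := P.NPhi_nonneg
  NA_nonneg := P.NA_nonneg
  e_nonneg := fun v => Nat.cast_nonneg _
  conn := Γ.conn
  u_le := fun v x => P.u_le v x
  K_le := fun l => KBd_zbK Γ ℓ hℓ amin aplus m2plus ha hk h1 h2 h3 h4 M hM l
  dir := Γ.dir
  Kb := zbKb Γ ℓ k M a m2
  cD := P.cD
  one_le_cD := P.one_le_cD
  single := zbCounts_single Γ ℓ hℓ amin aplus m2plus ha
  K_eq := fun l hne hd t x y => by
    have hS : Γ.DS l := DS_of_diffOn Γ ℓ hℓ amin aplus m2plus ha hne hd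
    show zbK Γ ℓ k M a m2 l t x y = _
    unfold zbK
    rw [if_pos hS, zb_Lpow_eq_s₀]
    rfl
  Kb_le := fun l hne hd => by
    have hS : Γ.DS l := DS_of_diffOn Γ ℓ hℓ amin aplus m2plus ha hne hd
    have h := KBd_zbKb Γ ℓ hℓ amin aplus m2plus ha hk h1 h2 h3 h4 M hM l
    refine h.of_eq ?_
    rw [zb_a, if_pos hS]
    push_cast
    ring
  u_face := fun l hne hd => by
    have hS : Γ.DS l := DS_of_diffOn Γ ℓ hℓ amin aplus m2plus ha hne hd
    have hder : Γ.der (Γ.src l) ≠ none := by unfold SDGraph.DS at hS; rw [hS]; exact Option.some_ne_none _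
    exact P.u_face (Γ.src l) hder
  du_le := fun l hne hd x => by
    have hS : Γ.DS l := DS_of_diffOn Γ ℓ hℓ amin aplus m2plus ha hne hd
    have hder : Γ.der (Γ.src l) ≠ none := by unfold SDGraph.DS at hS; rw [hS]; exact Option.some_ne_none _
    exact P.du_le (Γ.src l) hder x
  KdX_le := fun l μ h0 => by
    have hS : ¬ Γ.DS l := not_DS_of_diffOn Γ ℓ hℓ amin aplus m2plus ha h0
    have hK : zbK Γ ℓ k M a m2 l = zbKb Γ ℓ k M a m2 l := by unfold zbK; rw [if_neg hS]
    have hCpos := dconst_pos d ℓ hℓ amin aplus m2plus ha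
    have hC4 : (0 : ℝ) ≤ 4 * dconst d ℓ hℓ amin aplus m2plus ha := by positivity
    -- the forward difference of `K♭_l` in `x`, constant `4C`
    have h' : KBd (zbCounts Γ ℓ hℓ amin aplus m2plus ha).toModel k (4 * dconst d ℓ hℓ amin aplus m2plus ha)
        ((zbCounts Γ ℓ hℓ amin aplus m2plus ha).toModel.a l - 1)
        (fdX (((zbCounts Γ ℓ hℓ amin aplus m2plus ha).toModel.L : ℝ) ^ k) μ (zbKb Γ ℓ k M a m2 l)) := by
      rw [zb_Lpow_eq_s₀]
      refine KBd_of_rhs210 Γ ℓ hℓ amin aplus m2plus ha (n := (if Γ.DT l then 1 else 0) + 1) ?_ ?_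
      · rw [zb_a, if_neg hS]; push_cast; ring
      · intro t ht x y
        unfold zbKb
        by_cases hT : Γ.DT l
        · rw [if_pos hT, if_pos hT]
          exact abs_fdXY_cutK_le hℓ amin aplus m2plus ha hk h1 h2 h3 h4 hM ht μ _ x y
        · rw [if_neg hT, if_neg hT, zero_add]
          refine (abs_fdX_cutK_le hℓ amin aplus m2plus ha hk h1 h2 h3 h4 hM ht μ x y).trans ?_
          exact B3Ineq213ZeroBoxDiffLines.rhs210_mono ℓ k (by positivity) (by linarith) le_rfl 1 t x y
    have h'' := KBd.dK_tf_of_fdX μ h' hC4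
    show KBd _ k (Cz d ℓ hℓ amin aplus m2plus ha) _ (dK _ μ true false (zbK Γ ℓ k M a m2 l))
    rw [hK]
    exact KBd_Cz Γ ℓ hℓ amin aplus m2plus ha (c := 4) le_rfl (j := 1) (by norm_num)
      (by rw [pow_one]; exact h'')
  KdY_le := fun l ν h0 => by
    have hT : ¬ Γ.DT l := not_DT_of_diffOn Γ ℓ hℓ amin aplus m2plus ha h0
    have hCpos := dconst_pos d ℓ hℓ amin aplus m2plus ha
    have hC4 : (0 : ℝ) ≤ 4 * dconst d ℓ hℓ amin aplus m2plus ha := by positivity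
    -- the forward difference of `K_l` in `y`, constant `4C`
    have h' : KBd (zbCounts Γ ℓ hℓ amin aplus m2plus ha).toModel k (4 * dconst d ℓ hℓ amin aplus m2plus ha)
        ((zbCounts Γ ℓ hℓ amin aplus m2plus ha).toModel.a l - 1)
        (fdY (((zbCounts Γ ℓ hℓ amin aplus m2plus ha).toModel.L : ℝ) ^ k) ν (zbK Γ ℓ k M a m2 l)) := by
      rw [zb_Lpow_eq_s₀]
      refine KBd_of_rhs210 Γ ℓ hℓ amin aplus m2plus ha (n := (if Γ.DS l then 1 else 0) + 1) ?_ ?_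
      · rw [zb_a, if_neg hT]; push_cast; ring
      · intro t ht x y
        unfold zbK zbKb
        rw [if_neg hT]
        by_cases hS : Γ.DS l
        · rw [if_pos hS, if_pos hS]
          exact abs_fdYX_cutK_le hℓ amin aplus m2plus ha hk h1 h2 h3 h4 hM ht _ ν x y
        · rw [if_neg hS, if_neg hS, zero_add]
          refine (abs_fdY_cutK_le hℓ amin aplus m2plus ha hk h1 h2 h3 h4 hM ht ν x y).trans ?_
          exact B3Ineq213ZeroBoxDiffLines.rhs210_mono ℓ k (by positivity) (by linarith) le_rfl 1 t x y
    have h'' := KBd.dK_ft_of_fdY ν h' hC4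
    show KBd _ k (Cz d ℓ hℓ amin aplus m2plus ha) _ (dK _ ν false true (zbK Γ ℓ k M a m2 l))
    exact KBd_Cz Γ ℓ hℓ amin aplus m2plus ha (c := 4) le_rfl (j := 1) (by norm_num)
      (by rw [pow_one]; exact h'')
  KdXY_le := fun l μ ν h0 h0' => by
    have hS : ¬ Γ.DS l := not_DS_of_diffOn Γ ℓ hℓ amin aplus m2plus ha h0
    have hT : ¬ Γ.DT l := not_DT_of_diffOn Γ ℓ hℓ amin aplus m2plus ha h0'
    have hK : zbK Γ ℓ k M a m2 l = cutK ℓ k M a m2 := by unfold zbK zbKb; rw [if_neg hS, if_neg hT]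
    have hCpos := dconst_pos d ℓ hℓ amin aplus m2plus ha
    have hC4 : (0 : ℝ) ≤ 4 * dconst d ℓ hℓ amin aplus m2plus ha := by positivity
    have h' : KBd (zbCounts Γ ℓ hℓ amin aplus m2plus ha).toModel k (4 * dconst d ℓ hℓ amin aplus m2plus ha)
        ((zbCounts Γ ℓ hℓ amin aplus m2plus ha).toModel.a l - 2)
        (fdX (((zbCounts Γ ℓ hℓ amin aplus m2plus ha).toModel.L : ℝ) ^ k) μ
          (fdY (((zbCounts Γ ℓ hℓ amin aplus m2plus ha).toModel.L : ℝ) ^ k) ν (cutK ℓ k M a m2))) := by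
      rw [zb_Lpow_eq_s₀]
      refine KBd_of_rhs210 Γ ℓ hℓ amin aplus m2plus ha (n := 2) ?_
        fun t ht x y => abs_fdXY_cutK_le hℓ amin aplus m2plus ha hk h1 h2 h3 h4 hM ht μ ν x y
      rw [zb_a, if_neg hS, if_neg hT]; push_cast; ring
    have h'' := KBd.dKdK_of_fdXY μ ν h' hC4
    show KBd _ k (Cz d ℓ hℓ amin aplus m2plus ha) _ (dK _ μ true false (dK _ ν false true (zbK Γ ℓ k M a m2 l)))
    rw [hK]
    exact KBd_Cz Γ ℓ hℓ amin aplus m2plus ha (c := 4) le_rfl (j := 2) (by norm_num)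
      (by rw [pow_two, ← mul_assoc]; exact h'')

/-- The scale of `iboxAmp`. [cite: Balaban1983Higgs3, (2.13) p.426] -/
theorem iboxAmp_k : (iboxAmp Γ ℓ hℓ amin aplus m2plus ha hk h1 h2 h3 h4 M hM box P).k = k := rfl

/-- **The lines of `iboxAmp` ARE the difference quotients of the cut-off zero-field box pieces.** [cite: Balaban1983Higgs3, (2.10) p.426] -/
theorem iboxAmp_K (l : Fin m) : (iboxAmp Γ ℓ hℓ amin aplus m2plus ha hk h1 h2 h3 h4 M hM box P).K l = zbK Γ ℓ k M a m2 l := rfl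

/-- The kernel constants of `iboxAmp`. [cite: Balaban1983Higgs3, (2.10) p.426] -/
theorem iboxAmp_C (l : Fin m) :
    (iboxAmp Γ ℓ hℓ amin aplus m2plus ha hk h1 h2 h3 h4 M hM box P).C l = Cz d ℓ hℓ amin aplus m2plus ha := rfl

/-- **(1.33) for the total amplitude of a graph of the zero-field box class, (2.4)-blocks admitted, NO line hypothesis** — with
gen 4's explicit constant: if every component of the `G_i` along every ordering has positive degree or is a (2.4)-block, then
`|E| ≤ m!(m+1)^m(Π_l Cz)(1+e^{δ₁})^{2m}·unifConst215·cD^m·pref`. [cite: Balaban1983Higgs3, Prop. 2.1 p.424] -/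
theorem abs_Etot_iboxAmp_le
    (hyp : ∀ σ : Equiv.Perm (Fin m), ∀ i, i ≤ m →
      ∀ b ∈ (relabelCounts (zbCounts Γ ℓ hℓ amin aplus m2plus ha) σ).toModel.reps i,
        (relabelCounts (zbCounts Γ ℓ hℓ amin aplus m2plus ha) σ).toModel.Nontriv i b →
          Is24Block (relabelCounts (zbCounts Γ ℓ hℓ amin aplus m2plus ha) σ) i b ∨
            0 < (relabelCounts (zbCounts Γ ℓ hℓ amin aplus m2plus ha) σ).toModel.D i b) :
    |(iboxAmp Γ ℓ hℓ amin aplus m2plus ha hk h1 h2 h3 h4 M hM box P).toAmp.Etot|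
      ≤ (m.factorial : ℝ) * ((m + 1) ^ m : ℕ)
        * (((∏ _l : Fin m, Cz d ℓ hℓ amin aplus m2plus ha)
            * ((1 + Esh (zbCounts Γ ℓ hℓ amin aplus m2plus ha).toModel) ^ 2) ^ m)
          * unifConst215 (d + 1) (ℓ + 1) m (ddelta1 d ℓ hℓ amin aplus m2plus ha)
          * (P.cD ^ m * (iboxAmp Γ ℓ hℓ amin aplus m2plus ha hk h1 h2 h3 h4 M hM box P).toAmp.pref)) :=
  (iboxAmp Γ ℓ hℓ amin aplus m2plus ha hk h1 h2 h3 h4 M hM box P).abs_Etot_le_except24 hyp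

end Amplitude

/-! ## §6 The family of r15's carrier and Proposition 2.1 for it -/

/-- **The parameters of the family**: the dimension `d + 1`, `L = ℓ + 1 ≥ 2`, the window `a ∈ [a₋, a₊]` (`a₋ > 0`), `m² ∈ [0, m²₊]`
of the running constants, and the bound `CD` on the differentiated vertex bounds. [cite: Balaban1983Higgs3, Prop. 1 p.421] -/
structure ParamsZB where
  /-- `d + 1` is the dimension -/
  d : ℕ
  /-- `L = ℓ + 1` -/
  ℓ : ℕ
  hℓ : 1 ≤ ℓ
  /-- the window of the running constants -/
  amin : ℝ
  aplus : ℝ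
  m2plus : ℝ
  ha : 0 < amin
  /-- bound on the constants of the differentiated vertex bounds -/
  CD : ℝ

namespace ParamsZB

variable (P : ParamsZB)

/-- The gen-4 family parameters determined by ours: lattice constants `(d+1, ℓ+1, δ₁)`, `Cmax := Cz`, `CD`.
[cite: Balaban1983Higgs3, Prop. 1 p.421] -/
def toIBP : ParamsIBP where
  d := P.d + 1
  L := P.ℓ + 1
  δ₁ := ddelta1 P.d P.ℓ P.hℓ P.amin P.aplus P.m2plus P.ha
  Cmax := Cz P.d P.ℓ P.hℓ P.amin P.aplus P.m2plus P.ha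
  d_pos := Nat.succ_pos _
  two_le_L := by have := P.hℓ; omega
  δ₁_pos := ddelta1_pos P.d P.ℓ P.hℓ P.amin P.aplus P.m2plus P.ha
  CD := P.CD

end ParamsZB

/-- The graphs of the expansion at the size bound `mb`: the graphs of the class on the vertex sets `Fin n` with `m ≤ mb` lines.
[cite: Balaban1983Higgs3, Prop. 2.1 p.424] -/
structure CGraphZB (P : ParamsZB) (mb : ℕ) where
  /-- number of vertices -/
  n : ℕ
  /-- number of lines -/
  m : ℕ
  m_le : m ≤ mb
  /-- the graph -/
  Γ : SDGraph (Fin n) m P.d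

namespace CGraphZB

variable {P : ParamsZB} {mb : ℕ} (G : CGraphZB P mb)

/-- The count datum of a graph of the expansion. [cite: Balaban1983Higgs3, (2.14) p.427] -/
def counts : Counts (Fin G.n) G.m := zbCounts G.Γ P.ℓ P.hℓ P.amin P.aplus P.m2plus P.ha

end CGraphZB

/-- **The analytic datum of one expansion of the class** (the model's *"ε, k, Ω, …"*): the scale `k ≥ 1`, the window point
`(a, m²)`, the box sizes `M_i ≥ 1` (in unit blocks), the running couplings `> 0`, and for every graph and every localization the
vertex datum (orders independent of the localization, `cD ≤ CD`). [cite: Balaban1983Higgs3, Prop. 1 p.421] -/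
structure DatumZB (P : ParamsZB) where
  /-- number of completed renormalization steps -/
  k : ℕ
  hk : 1 ≤ k
  /-- the running constant `a_k` of the window -/
  a : ℝ
  /-- the mass `m²` -/
  m2 : ℝ
  h1 : P.amin ≤ a
  h2 : a ≤ P.aplus
  h3 : 0 ≤ m2
  h4 : m2 ≤ P.m2plus
  /-- the box `□ = Π_i [0, M_i)` in unit blocks -/
  M : Fin (P.d + 1) → ℕ
  hM : ∀ i, 1 ≤ M i
  /-- `e(L^kε)` -/
  eRun : ℝ
  /-- `λ(L^kε)` -/
  lamRun : ℝ
  eRun_pos : 0 < eRun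
  lamRun_pos : 0 < lamRun
  /-- the vertex datum of each graph at each localization -/
  vtx : ∀ {n m : ℕ} (Γ : SDGraph (Fin n) m P.d) (box : Fin n → Fin (P.d + 1) → ℕ), VertexDataIBP Γ P.ℓ k box
  vtx_eRun : ∀ {n m : ℕ} (Γ : SDGraph (Fin n) m P.d) (box : Fin n → Fin (P.d + 1) → ℕ), (vtx Γ box).eRun = eRun
  vtx_lamRun : ∀ {n m : ℕ} (Γ : SDGraph (Fin n) m P.d) (box : Fin n → Fin (P.d + 1) → ℕ), (vtx Γ box).lamRun = lamRun
  /-- the orders do not depend on the localization -/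
  vtx_dv : ∀ {n m : ℕ} (Γ : SDGraph (Fin n) m P.d) (box box' : Fin n → Fin (P.d + 1) → ℕ), (vtx Γ box).dv = (vtx Γ box').dv
  vtx_ds : ∀ {n m : ℕ} (Γ : SDGraph (Fin n) m P.d) (box box' : Fin n → Fin (P.d + 1) → ℕ), (vtx Γ box).ds = (vtx Γ box').ds
  /-- the constants of the differentiated vertex bounds are bounded by `CD` -/
  vtx_cD_le : ∀ {n m : ℕ} (Γ : SDGraph (Fin n) m P.d) (box : Fin n → Fin (P.d + 1) → ℕ), (vtx Γ box).cD ≤ P.CD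

namespace DatumZB

variable {P : ParamsZB} (D : DatumZB P)

/-- The amplitude of the graph `G` of the expansion at the localization `box`. [cite: Balaban1983Higgs3, Prop. 2.1 p.424] -/
def amp {mb : ℕ} (G : CGraphZB P mb) (box : Fin G.n → Fin (P.d + 1) → ℕ) : IBPAmp₁ G.counts :=
  iboxAmp G.Γ P.ℓ P.hℓ P.amin P.aplus P.m2plus P.ha D.hk D.h1 D.h2 D.h3 D.h4 D.M D.hM box (D.vtx G.Γ box)

end DatumZB

/-- The reference localization used to read off the (localization-independent) orders. [cite: Balaban1983Higgs3, (1.33) p.420] -/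
def boxZ {n dd : ℕ} : Fin n → Fin dd → ℕ := fun _ _ => 0

/-- **The multi-graph expansion of r15's carrier for the zero-field box class** (datum `D`, size bound `mb`): classes = graphs =
`CGraphZB P mb`; `E({G}, {□(v)}, ·, ·)` = the total amplitude of `iboxAmp` at `{□(v)}`; `d({□(v)})` = `boxTreeLen`; norms
`Π_v N^Φ_v`, `Π_v N^A_v`; orders `Σ_v d_v(v)`, `Σ_v d_s(v)`; connected subgraphs = the components of the `G_i` along every ordering
with degrees `degQ`; `Is24` := the component is a (2.4)-block (`Is24Block`). [cite: Balaban1983Higgs3, Prop. 2.1 p.424] -/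
def expansionZB (P : ParamsZB) (mb : ℕ) (D : DatumZB P) : GraphExpansion where
  eRun := D.eRun
  lamRun := D.lamRun
  eRun_pos := D.eRun_pos
  lamRun_pos := D.lamRun_pos
  RenClass := CGraphZB P mb
  Loc := fun G => Fin G.n → Fin (P.d + 1) → ℕ
  ExtS := Unit
  ExtV := Unit
  E := fun G box _ _ => (D.amp G box).toAmp.Etot
  ds := fun G => ∑ v, (D.vtx G.Γ boxZ).ds v
  dv := fun G => ∑ v, (D.vtx G.Γ boxZ).dv v
  treeLen := fun _ box => boxTreeLen (P.ℓ + 1) D.k box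
  treeLen_nonneg := fun _ box => boxTreeLen_nonneg (P.ℓ + 1) D.k box
  normS := fun _ G box _ => ∏ v, (D.vtx G.Γ box).NPhi v
  normV := fun _ G box _ => ∏ v, (D.vtx G.Γ box).NA v
  normS_nonneg := fun _ G box _ => prod_nonneg fun v _ => (D.vtx G.Γ box).NPhi_nonneg v
  normV_nonneg := fun _ G box _ => prod_nonneg fun v _ => (D.vtx G.Γ box).NA_nonneg v
  Graph := CGraphZB P mb
  single := id
  Connected := fun _ => True
  Sub := fun G => Component G.counts
  subDeg := fun G H => degQ (relabelCounts G.counts H.1) H.2.1 H.2.2.1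
  Is24 := fun G H => Is24Block (relabelCounts G.counts H.1) H.2.1 H.2.2.1

/-- The family `fam n̄ D` of r15's `Prop21`: at level `n̄` the graphs have at most `mbar n̄` lines. [cite: Balaban1983Higgs3, Prop. 2.1 p.424] -/
def famZB (P : ParamsZB) (mbar : ℕ → ℕ) : ℕ → DatumZB P → GraphExpansion :=
  fun nbar D => expansionZB P (mbar nbar) D

/-- The printed hypothesis, read on the expansion: every component of every `G_i` along every ordering is a (2.4)-block or has
positive (ℝ-valued) degree. [cite: Balaban1983Higgs3, Prop. 2.1 p.424] -/
theorem hyp_of_posSubgraphsExcept24_zb {P : ParamsZB} {mb : ℕ} {D : DatumZB P} {G : CGraphZB P mb}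
    (h : PosSubgraphsExcept24 (expansionZB P mb D) G) (σ : Equiv.Perm (Fin G.m)) :
    ∀ i, i ≤ G.m → ∀ b ∈ (relabelCounts G.counts σ).toModel.reps i, (relabelCounts G.counts σ).toModel.Nontriv i b →
      Is24Block (relabelCounts G.counts σ) i b ∨ 0 < (relabelCounts G.counts σ).toModel.D i b := by
  intro i hi b hb hn
  have h' := h.2 ⟨σ, ⟨i, Nat.lt_succ_of_le hi⟩, ⟨b, hb, hn⟩⟩
  rcases h' with h24 | hpos
  · exact Or.inl h24
  · right
    have hc := cast_degQ (relabelCounts G.counts σ) i b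
    have : (0 : ℝ) < ((degQ (relabelCounts G.counts σ) i b : ℚ) : ℝ) := by exact_mod_cast hpos
    rw [hc] at this
    exact this

/-- **Proposition 2.1 with the (2.4) exception for the ZERO-FIELD BOX LINE CLASS — r15's `B3Prop1.Prop21` INHABITED with the line
side hypothesis-free**: `δ₀ := ½δ₁(d, L, window)` first; given α₀ and n̄ the single constant `O(1)(n̄) := unifO1x` (gen 4); then for
EVERY datum (scale, window point, box, couplings, vertex data) and every graph of the class with at most `mbar n̄` lines all of
whose components (of the `G_i`, every ordering) have positive degree OR ARE (2.4)-BLOCKS, (1.33) for all localizations — the line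
kernels being the genuine difference quotients of the cut-off zero-field box pieces `G^η_{(t)}(□,0)`.
[cite: Balaban1983Higgs3, Prop. 2.1 p.424] -/
theorem prop21_zeroBox (P : ParamsZB) (mbar : ℕ → ℕ) : Prop21 (famZB P mbar) := by
  classical
  refine ⟨P.toIBP.δ₁ / 2, half_pos P.toIBP.δ₁_pos, fun α₀ _ _ nbar => ?_⟩
  refine ⟨unifO1x P.toIBP (mbar nbar), unifO1x_pos P.toIBP (mbar nbar), fun D G hG => ?_⟩
  intro box Φ Aext
  change Fin G.n → Fin (P.d + 1) → ℕ at box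
  set A : IBPAmp₁ G.counts := D.amp G box with hA
  have hyp := fun σ => hyp_of_posSubgraphsExcept24_zb hG σ
  have hfin : |A.toAmp.Etot| ≤ unifO1x P.toIBP (mbar nbar) * A.toAmp.pref :=
    A.abs_Etot_le_unifO1x P.toIBP rfl rfl rfl G.m_le (fun l => le_rfl) (D.vtx_cD_le G.Γ box) hyp
  -- assemble in the shape of `Ineq133At`
  show |A.toAmp.Etot| ≤ unifO1x P.toIBP (mbar nbar) * D.eRun ^ (∑ v, (D.vtx G.Γ boxZ).dv v)
      * D.lamRun ^ (∑ v, (D.vtx G.Γ boxZ).ds v) * Real.exp (-(P.toIBP.δ₁ / 2 * boxTreeLen (P.ℓ + 1) D.k box))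
      * (∏ v, (D.vtx G.Γ box).NPhi v) * (∏ v, (D.vtx G.Γ box).NA v)
  have e : A.toAmp.pref = D.eRun ^ (∑ v, (D.vtx G.Γ boxZ).dv v) * D.lamRun ^ (∑ v, (D.vtx G.Γ boxZ).ds v)
      * Real.exp (-(P.toIBP.δ₁ / 2 * boxTreeLen (P.ℓ + 1) D.k box)) * (∏ v, (D.vtx G.Γ box).NPhi v)
      * (∏ v, (D.vtx G.Γ box).NA v) := by
    have he : A.eRun = D.eRun := D.vtx_eRun G.Γ box
    have hl : A.lamRun = D.lamRun := D.vtx_lamRun G.Γ box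
    have hdv : A.dv = (D.vtx G.Γ boxZ).dv := D.vtx_dv G.Γ box boxZ
    have hds : A.ds = (D.vtx G.Γ boxZ).ds := D.vtx_ds G.Γ box boxZ
    unfold Amp.pref
    rw [he, hl, hdv, hds]
    rfl
  calc |A.toAmp.Etot| ≤ unifO1x P.toIBP (mbar nbar) * A.toAmp.pref := hfin
    _ = _ := by rw [e]; ring

/-- The same family inhabits r15's `B3Prop1.Prop22`. [cite: Balaban1983Higgs3, Prop. 2.2 p.428] -/
theorem prop22_zeroBox (P : ParamsZB) (mbar : ℕ → ℕ) : Prop22 (famZB P mbar) :=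
  prop21_zeroBox P mbar

/-! ## Non-vacuity -/

/-- **A datum exists** (for `a₋ ≤ a₊`, `0 ≤ m²₊`, `1 ≤ CD`): scale `1`, the corner of the window, the unit box, couplings `1`, the
zero vertex data. [cite: Balaban1983Higgs3, Prop. 2.1 p.424] -/
def DatumZB.basic (P : ParamsZB) (hw : P.amin ≤ P.aplus) (hm : 0 ≤ P.m2plus) (hD : 1 ≤ P.CD) : DatumZB P where
  k := 1
  hk := le_rfl
  a := P.amin
  m2 := 0
  h1 := le_rfl
  h2 := hw
  h3 := le_rfl
  h4 := hm
  M := fun _ => 1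
  hM := fun _ => le_rfl
  eRun := 1
  lamRun := 1
  eRun_pos := one_pos
  lamRun_pos := one_pos
  vtx := fun Γ box => VertexDataIBP.zero Γ P.ℓ 1 box
  vtx_eRun := fun _ _ => rfl
  vtx_lamRun := fun _ _ => rfl
  vtx_dv := fun _ _ _ => rfl
  vtx_ds := fun _ _ _ => rfl
  vtx_cD_le := fun _ _ => hD

/-- The datum type is inhabited. [cite: Balaban1983Higgs3, Prop. 2.1 p.424] -/
theorem datumZB_nonempty (P : ParamsZB) (hw : P.amin ≤ P.aplus) (hm : 0 ≤ P.m2plus) (hD : 1 ≤ P.CD) :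
    Nonempty (DatumZB P) :=
  ⟨DatumZB.basic P hw hm hD⟩

end

end Literature.MathematicalPhysics.QuantumFieldTheory.Balaban1983to89.B3IBPZeroBox
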